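import Literature.MathematicalPhysics.QuantumFieldTheory.Balaban1983to89.B9CubeDirInverseBondLocalityAtRecordY
import Literature.MathematicalPhysics.QuantumFieldTheory.Balaban1983to89.B9Eq3115KnitCubeLetterY

/-!
# `Balaban1983to89.B9CubeDirInverseBondCLocalityAtRecordY` — [Balaban1985BackgroundPropagators] p. 410 l. 14–15 («the operators G′_□(U), … depend on U restricted
# to Ω₀(□) ⊂ □̃⁵»), p. 413 («it depends on U restricted to X̃⁵») FOR THE DIRICHLET BOND-SECTOR INVERSE `G_□(U)` OF p. 409 l. 3–5 AT THE (C) LETTER OF RECORD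
# `GDirCKY i □ (DP_□D* of record) (bondsOverY Ω₀)` — the cube sequence's own knit averaging pair: `G_□(U) = G_□(U′)` whenever `U = U′` on what the letters read over
# `Ω₀(□)`; the cube-pair twin of ✓`B9CubeDirInverseBondLocalityY` ∕ ✓`B9CubeDirInverseBondLocalityAtRecordY`

T. Bałaban, *Propagators for lattice gauge theories in a background field*, Commun. Math. Phys. **99** (1985) 389–434 [Balaban1985BackgroundPropagators] = [B9]: p. 409 l. 1–5
(the operators `G′_□(U), C_□(U), G_□(U)` of the sequence `{Ω_n(□)}`), p. 410 l. 14–15, p. 413, (3.25)–(3.27) pp. 394–395, (3.10) p. 392, (3.12)–(3.14) p. 393 («Q … is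
a local operator»), (3.19) + (3.21) + (3.24) pp. 393–395; T. Bałaban, *Averaging operations for lattice gauge theories*, Commun. Math. Phys. **98** (1985) 17–51
[Balaban1985Averaging]: p. 24 (locality of the averaging after (43)).

WHY THIS FILE (seat dag-n06-d g34; the (C) re-key of the N06 heads' bond letter, dag-n06-c LOCATED-34 ∕ this seat's ANSWER, 2026-08-31).  The tree head «KE₁₇X-Aγ» CONSUMED
the locality row `hOagrA` of the bond tables at the (M) letter `GDirBY 𝔮ʳᵉᶜ 𝔮⋆ʳᵉᶜ (DP_□D*) (bondsOverY Ω₀)` by ✓`GDirBY_DPDsDirCubeY_congr_of_agree310WalkYO`.  The (C) heads key the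
letter on the cube sequence's knit pair (`GDirCKY`); this file is the twin of that chain at a CUBE-INDEXED pair, so that the (C) heads keep `hOagrA` a theorem:
* §1 (generic cube pair `(𝔮_□, 𝔮⋆_□)`, generic `𝔸`): pointwise locality of `Δ_{loc,□}[𝔮_□](U)` (`deltaLocCQY_apply_congr`), the (L2) law `IsLocalQC D 𝔮_□` and the row locality
  `IsLocalQCs D 𝔮⋆_□` relative to a dependency assignment on the cube sequence's index bonds, `qc_congr_of_isLocalQC`; over `M_N(ℂ)`: the generic adjoint inherits the
  row locality (`adjTrY_apply_congr_of_isLocalQC`, `isLocalQCs_adjTrY`); AT THE KNIT PAIR: ★ `isLocalQC_QknitCubeY`, `isLocalQCs_QsknitCubeY` (dependency sets `knitDepP i ι.1`);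
  ★★ `GDirCY_DPDsCubeDY_congr` ∕ `padDeltaLocCY_DPDsCubeDY_congr` (`G_□(U) = G_□(U′)` at generic letters from `P_□`-, `G′Ω₀`-, bond-, plaquette-, `𝔮_□`-, `𝔮⋆_□`-agreement);
* §2 at the letters OF RECORD (`DP_□D* = DPDsDirCubeY i □ S`, `B = bondsOverY S`): the agreement predicate `AgreeDirCY i □ D S U U′` (clauses (i)–(iii) of ✓`AgreeDirBY`, clause
  (iv) over the cube sequence's index bonds), ★★★ `GDirCY_DPDsDirCubeY_congr` ∕ `padDeltaLocCY_DPDsDirCubeY_congr` ∕ `isUnit_padDeltaLocCY_DPDsDirCubeY_iff`, and at the knit pair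
  ★★★ `GDirCKY_congr_of_agreeDirCY`;
* §3 at a member: `agreeDirCY_of_agree310WalkYO` (from ✓`agreeDirBY_of_agree310WalkYO` for (i)–(iii)) and ★★★ `GDirCKY_congr_of_agree310WalkYO` — THE `hOagrA` ROW OF THE (C)
  HEADS — plus `isUnit_padDeltaLocCY_knit_iff_of_agree310WalkYO` (the regime rows of record agree under the same reading); displayed: the two geometric inclusions
  (`bondReadSetY ⊆ near □`; the knit dependency sets of the cube sequence's index bonds meeting `Ω₀(□)` read in `near □`).

HONEST SCOPE.  Exact finite algebra + bookkeeping over landed modules; no inequality; the geometric inclusions are HYPOTHESES (print: all of it lies in `□̃⁵`).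
Count-neutral (`--supports stmt-QuantumFields-27239`); N06 NOT discharged; nothing continuum ∕ OS ∕ mass gap ∕ Clay — the Yang–Mills mass gap is NOT proved by any of this.
NEW file; nothing landed is modified; no `sorry`, no `axiom`, no `instance`, no `notation`.  Net new unproved facts: 0 (three `Prop`-valued bookkeeping `def`s with
bodies — locality predicates and the agreement predicate, NOT hypotheses of published results — and theorems).
-/

noncomputable section

namespace Literature.MathematicalPhysics.QuantumFieldTheory.Balaban1983to89.B9CubeDirInverseBondCLocalityAtRecordY

open B6KLevelCensusIndexV1 (KIdx)
open B6Cover236MultiLevelBlocks (cubes)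
open B6GlobalChartV1 (PV)
open B9CubeLettersBondOpsL0 (BlkCubeY IBondCubeY aCubeY)
open B9Thm37CubeCoverCommutators (cutMulY)
open B9CubeDirInverseKnitCubeLawsY (blkHullCubeY)
open B9PinMembersKLevelV1 (MemberY)
open B9Thm310CommutatorDataOfPlaquettes (UboxY_chartY)
open B9CubeDirInverseBondLocalityY (DPDsCubeDY_apply_congr)
open B9CubeDirInverseBondLocalityAtRecordY (PDirCubeY_congr_of_agree AgreeDirBY bondReadSetY agreeDirBY_of_agree310WalkYO)
open B9DirichletBondCubePairY (QCLetterY QCsLetterY deltaLocCQY padDeltaLocCY GDirCY GDirCY_congr_of_apply padDeltaLocCY_congr_of_apply)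
open B9Eq3115KnitCubeLetterY (knitDepP QknitCubeY QsknitCubeY QsknitCubeY_apply QknitCubeY_apply_congr GDirCKY)
open B9WalkLettersOps310 (agree310WalkYO)
open Node00
open Node00.OpsYNablaBridge (chartY)
open Node00.OpsYLocalInverse (cubeProjY)
open Node00.OpsYDeltaALocalAgree (PlaqAgreeY hessY_apply_congr gradY_apply_congr divY_apply_congr)
open Node00.OpsYCubeDirInverse (GpDirY GpDirY_mul_cubeProjY)
open Node00.OpsYCubeKnitPar (parKnitCubeY)
open Node00.OpsYCubeProjectionG (insideBlkY PCubeDY DPDsCubeDY DPDsDirCubeY)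
open Node00.OpsYCubeDirInverseBond (bondsOverY mem_bondsOverY)
open Node00.OpsYQLetter (adjTrY adjTrY_apply unitFnY)
open scoped Matrix Matrix.Norms.L2Operator

variable {d ℓ : ℕ} {hd : 1 ≤ d + 1} {hL : Odd (ℓ + 1) ∧ 1 < ℓ + 1} {b₀ b₁ : ℝ}
variable {𝔸 : Type} [NormedRing 𝔸] [NormedAlgebra ℂ 𝔸] [CompleteSpace 𝔸]

/-! ## §1 Locality of the cube-pair letters: `Δ_{loc,□}[𝔮_□]`, the (L2) laws on the cube sequence's index bonds, `G_□(U) = G_□(U′)` at generic letters -/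

section DeltaLoc

variable (i : KIdx d ℓ hd hL b₀ b₁) (q : ↥(cubes (toKT i).D.toDomains))

/-- pointwise locality of `Δ_{loc,□}[𝔮_□](U)A` at a bond `b`: the Hessian's rows read the plaquettes through `b`, `DD*` the bond `b` and the support of `A`, and the
averaging term reads `𝔮_□(U)A` and the `b`-row of `𝔮⋆_□(U)` (the twin of ✓`deltaLocQY_apply_congr`). [cite: Balaban1985BackgroundPropagators, (3.10) p.392, (3.12)–(3.14) p.393, p.410 L14–15, p.413] -/
theorem deltaLocCQY_apply_congr {𝔮c : QCLetterY 𝔸 i q} {𝔮cs : QCsLetterY 𝔸 i q} {U U' : CfgY 𝔸 i} {A : FBondY i → 𝔸} {b : FBondY i}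
    (hp : ∀ p, (cocurlK i b p ≠ 0 ∨ ∃ m, edgeY i p m = b) → PlaqAgreeY i U U' p) (hb : U b.dir b.src = U' b.dir b.src)
    (hA : ∀ b', A b' ≠ 0 → U b'.dir b'.src = U' b'.dir b'.src) (hq : 𝔮c U A = 𝔮c U' A) (hqs : ∀ v, 𝔮cs U v b = 𝔮cs U' v b) :
    deltaLocCQY i q 𝔮c 𝔮cs U A b = deltaLocCQY i q 𝔮c 𝔮cs U' A b := by
  simp only [deltaLocCQY, LinearMap.add_apply, Pi.add_apply, LinearMap.coe_comp, Function.comp_apply]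
  have hdiv : divY i U A = divY i U' A := funext fun z => divY_apply_congr fun b' _ => ⟨rfl, fun h => hA b' h⟩
  rw [hessY_apply_congr hp A, hdiv, gradY_apply_congr hb fun _ _ => rfl, hq, hqs]

/-- ★ **THE (L2) LAW OF AN AVERAGING LETTER OF THE CUBE SEQUENCE** relative to a dependency assignment `D` on its index bonds: `(𝔮_□(U)a)(ι)` reads `U` and `a` only on `D ι`
(def-Y's `IsLocalQ`, cube-indexed). [cite: Balaban1985BackgroundPropagators, (3.12)–(3.14) p.393 («Q … is a local operator»), p.413, dictionary] -/
def IsLocalQC (D : IBondCubeY i q → Set (FBondY i)) (𝔮c : QCLetterY 𝔸 i q) : Prop :=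
  ∀ (U U' : CfgY 𝔸 i) (a a' : FBondY i → 𝔸) (ι : IBondCubeY i q),
    (∀ b ∈ D ι, U b.dir b.src = U' b.dir b.src) → (∀ b ∈ D ι, a b = a' b) → 𝔮c U a ι = 𝔮c U' a' ι

/-- ★ **ROW LOCALITY OF AN ADJOINT AVERAGING LETTER OF THE CUBE SEQUENCE**: the `b`-row `(𝔮⋆_□(U)v)(b)` reads `U` only on the dependency sets `D ι ∋ b`.
[cite: Balaban1985BackgroundPropagators, (3.13) p.393 («Q*»), p.413, dictionary] -/
def IsLocalQCs (D : IBondCubeY i q → Set (FBondY i)) (𝔮cs : QCsLetterY 𝔸 i q) : Prop :=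
  ∀ (U U' : CfgY 𝔸 i) (b : FBondY i), (∀ ι, b ∈ D ι → ∀ b' ∈ D ι, U b'.dir b'.src = U' b'.dir b'.src) → ∀ v, 𝔮cs U v b = 𝔮cs U' v b

variable {i q}

/-- ★ the (L2) law delivers `𝔮_□(U)A = 𝔮_□(U′)A` for fields supported in `B`, if `U ≡ U′` on every dependency set meeting `B`. [cite: Balaban1985BackgroundPropagators, (3.12)–(3.14) p.393, p.413] -/
theorem qc_congr_of_isLocalQC {D : IBondCubeY i q → Set (FBondY i)} {𝔮c : QCLetterY 𝔸 i q} (hloc : IsLocalQC i q D 𝔮c) {B : Finset (FBondY i)} {U U' : CfgY 𝔸 i}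
    (hD : ∀ ι, (∃ b ∈ D ι, b ∈ B) → ∀ b ∈ D ι, U b.dir b.src = U' b.dir b.src) {A : FBondY i → 𝔸} (hA : ∀ b, b ∉ B → A b = 0) :
    𝔮c U A = 𝔮c U' A := by
  refine funext fun ι => ?_
  by_cases h : ∃ b ∈ D ι, b ∈ B
  · exact hloc U U' A A ι (hD ι h) fun _ _ => rfl
  · have h0 : ∀ b ∈ D ι, A b = (0 : FBondY i → 𝔸) b := fun b hb => hA b fun hbB => h ⟨b, hb, hbB⟩
    rw [hloc U U A 0 ι (fun _ _ => rfl) h0, hloc U' U' A 0 ι (fun _ _ => rfl) h0, map_zero, map_zero]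

variable (i q) in
/-- ★ **(L2) FOR THE KNIT LETTER OF THE CUBE SEQUENCE** with its dependency sets `knitDepP i ι.1` (✓`QknitCubeY_apply_congr`). [cite: Balaban1985BackgroundPropagators, (3.12)–(3.15) p.393; Balaban1985Averaging, p.24] -/
theorem isLocalQC_QknitCubeY [NormOneClass 𝔸] : IsLocalQC i q (fun ι => knitDepP i ι.1) (QknitCubeY (𝔸 := 𝔸) i q) :=
  fun _ _ _ _ ι hU ha => QknitCubeY_apply_congr i q ι hU ha

end DeltaLoc

section Adjoint

variable {N : ℕ} {i : KIdx d ℓ hd hL b₀ b₁} {q : ↥(cubes (toKT i).D.toDomains)}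

/-- ★ the (L2) law delivers the `b`-row of the generic adjoint `adjTrY (𝔮_□ U)` (it reads `𝔮_□(·)(δ_b ⊗ E)`, vanishing at the index bonds whose dependency set misses `b`).
[cite: Balaban1985BackgroundPropagators, (3.13) p.393, p.413] -/
theorem adjTrY_apply_congr_of_isLocalQC {D : IBondCubeY i q → Set (FBondY i)} {𝔮c : QCLetterY (Matrix (Fin N) (Fin N) ℂ) i q} (hloc : IsLocalQC i q D 𝔮c)
    {U U' : CfgY (Matrix (Fin N) (Fin N) ℂ) i} {b : FBondY i} (hD : ∀ ι, b ∈ D ι → ∀ b' ∈ D ι, U b'.dir b'.src = U' b'.dir b'.src)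
    (v : IBondCubeY i q → Matrix (Fin N) (Fin N) ℂ) : adjTrY (𝔮c U) v b = adjTrY (𝔮c U') v b := by
  refine Matrix.ext fun a c => ?_
  rw [adjTrY_apply, adjTrY_apply]
  have key : 𝔮c U (unitFnY b a c) = 𝔮c U' (unitFnY b a c) := by
    refine funext fun ι => ?_
    by_cases hι : b ∈ D ι
    · exact hloc U U' _ _ ι (hD ι hι) fun _ _ => rfl
    · have h0 : ∀ b' ∈ D ι, unitFnY b a c b' = (0 : FBondY i → Matrix (Fin N) (Fin N) ℂ) b' := fun b' hb' => by
        have hne : b' ≠ b := fun h => hι (h ▸ hb')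
        unfold unitFnY
        rw [Pi.single_eq_of_ne hne, Pi.zero_apply]
      rw [hloc U U _ 0 ι (fun _ _ => rfl) h0, hloc U' U' _ 0 ι (fun _ _ => rfl) h0, map_zero, map_zero]
  rw [key]

/-- ★ hence (L2) for `𝔮_□` gives the row locality of `U ↦ adjTrY (𝔮_□ U)`. [cite: Balaban1985BackgroundPropagators, (3.13) p.393, p.413] -/
theorem isLocalQCs_adjTrY {D : IBondCubeY i q → Set (FBondY i)} {𝔮c : QCLetterY (Matrix (Fin N) (Fin N) ℂ) i q} (hloc : IsLocalQC i q D 𝔮c) :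
    IsLocalQCs i q D (fun U => adjTrY (𝔮c U)) := fun _ _ _ hD v =>
  adjTrY_apply_congr_of_isLocalQC hloc hD v

variable (i q) in
/-- ★ at the knit pair of the cube sequence: the row locality of `Q*_□ = QsknitCubeY`. [cite: Balaban1985BackgroundPropagators, (3.13) p.393, p.413] -/
theorem isLocalQCs_QsknitCubeY [Nonempty (Fin N)] : IsLocalQCs i q (fun ι => knitDepP i ι.1) (QsknitCubeY (N := N) i q) :=
  isLocalQCs_adjTrY (isLocalQC_QknitCubeY i q)

end Adjoint

section Generic

variable {i : KIdx d ℓ hd hL b₀ b₁} {q : ↥(cubes (toKT i).D.toDomains)}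
variable {parS : SiteParY 𝔸 i} {Gp : SiteOpY 𝔸 i} {S : Finset (SiteY i)} {𝔮c : QCLetterY 𝔸 i q} {𝔮cs : QCsLetterY 𝔸 i q} {U U' : CfgY 𝔸 i}

/-- the hypothesis of ✓`GDirCY_congr_of_apply` ∕ ✓`padDeltaLocCY_congr_of_apply` at `Pl = D P_□ D*`, `B = bondsOverY S`, from the letters' pointwise locality.
[cite: Balaban1985BackgroundPropagators, p.409 l.3–5, p.410 L14–15, (3.105) p.414] -/
theorem deltaLocC_sub_DPDsCubeDY_apply_congr (𝔖 : Finset (BlkCubeY i q)) (hP : PCubeDY i q parS Gp 𝔖 U = PCubeDY i q parS Gp 𝔖 U')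
    (hPr : Gp U' * cubeProjY i S = Gp U') (hB : ∀ b : FBondY i, chartY i b.src ∈ S → U b.dir b.src = U' b.dir b.src)
    (hp : ∀ b : FBondY i, chartY i b.src ∈ S → ∀ p, (cocurlK i b p ≠ 0 ∨ ∃ m, edgeY i p m = b) → PlaqAgreeY i U U' p)
    (hq : ∀ A : FBondY i → 𝔸, (∀ b, b ∉ bondsOverY i S → A b = 0) → 𝔮c U A = 𝔮c U' A)
    (hqs : ∀ b : FBondY i, chartY i b.src ∈ S → ∀ v, 𝔮cs U v b = 𝔮cs U' v b) :
    ∀ A : FBondY i → 𝔸, (∀ b, b ∉ bondsOverY i S → A b = 0) →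
      ∀ b ∈ bondsOverY i S, (deltaLocCQY i q 𝔮c 𝔮cs U - DPDsCubeDY i q parS Gp 𝔖 U) A b = (deltaLocCQY i q 𝔮c 𝔮cs U' - DPDsCubeDY i q parS Gp 𝔖 U') A b := by
  intro A hA b hb
  have hbS : chartY i b.src ∈ S := (mem_bondsOverY i).1 hb
  have hA' : ∀ b', A b' ≠ 0 → U b'.dir b'.src = U' b'.dir b'.src := fun b' h =>
    hB b' ((mem_bondsOverY i).1 (by by_contra h'; exact h (hA b' h')))
  rw [LinearMap.sub_apply, LinearMap.sub_apply, Pi.sub_apply, Pi.sub_apply,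
    deltaLocCQY_apply_congr i q (hp b hbS) (hB b hbS) hA' (hq A hA) (hqs b hbS), DPDsCubeDY_apply_congr 𝔖 hP hPr hA' (hB b hbS)]

/-- ★★ **`G_□(U) = G_□(U′)` AT A GENERIC CUBE PAIR** (`Pl_□ = D P_□ D*` over the cube sequence's blocks, `B = bondsOverY S`): from `P_□(U) = P_□(U′)`, `G′(U′)Ω₀ = G′(U′)`, bond
agreement over `S`, plaquette agreement around the bonds over `S`, and the `𝔮_□`-∕`𝔮⋆_□`-agreements over `S`. [cite: Balaban1985BackgroundPropagators, p.409 l.3–5 («G_□(U)»), p.410 L14–15, p.413, (3.105) p.414] -/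
theorem GDirCY_DPDsCubeDY_congr (𝔖 : Finset (BlkCubeY i q)) (hP : PCubeDY i q parS Gp 𝔖 U = PCubeDY i q parS Gp 𝔖 U')
    (hPr : Gp U' * cubeProjY i S = Gp U') (hB : ∀ b : FBondY i, chartY i b.src ∈ S → U b.dir b.src = U' b.dir b.src)
    (hp : ∀ b : FBondY i, chartY i b.src ∈ S → ∀ p, (cocurlK i b p ≠ 0 ∨ ∃ m, edgeY i p m = b) → PlaqAgreeY i U U' p)
    (hq : ∀ A : FBondY i → 𝔸, (∀ b, b ∉ bondsOverY i S → A b = 0) → 𝔮c U A = 𝔮c U' A)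
    (hqs : ∀ b : FBondY i, chartY i b.src ∈ S → ∀ v, 𝔮cs U v b = 𝔮cs U' v b) :
    GDirCY i q 𝔮c 𝔮cs (DPDsCubeDY i q parS Gp 𝔖) (bondsOverY i S) U = GDirCY i q 𝔮c 𝔮cs (DPDsCubeDY i q parS Gp 𝔖) (bondsOverY i S) U' :=
  GDirCY_congr_of_apply i q 𝔮c 𝔮cs _ _ (deltaLocC_sub_DPDsCubeDY_apply_congr 𝔖 hP hPr hB hp hq hqs)

/-- ★ and the regime object agrees likewise. [cite: Balaban1985BackgroundPropagators, p.409 l.3–5, p.410 L14–15, bookkeeping] -/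
theorem padDeltaLocCY_DPDsCubeDY_congr (𝔖 : Finset (BlkCubeY i q)) (hP : PCubeDY i q parS Gp 𝔖 U = PCubeDY i q parS Gp 𝔖 U')
    (hPr : Gp U' * cubeProjY i S = Gp U') (hB : ∀ b : FBondY i, chartY i b.src ∈ S → U b.dir b.src = U' b.dir b.src)
    (hp : ∀ b : FBondY i, chartY i b.src ∈ S → ∀ p, (cocurlK i b p ≠ 0 ∨ ∃ m, edgeY i p m = b) → PlaqAgreeY i U U' p)
    (hq : ∀ A : FBondY i → 𝔸, (∀ b, b ∉ bondsOverY i S → A b = 0) → 𝔮c U A = 𝔮c U' A)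
    (hqs : ∀ b : FBondY i, chartY i b.src ∈ S → ∀ v, 𝔮cs U v b = 𝔮cs U' v b) :
    padDeltaLocCY i q 𝔮c 𝔮cs (DPDsCubeDY i q parS Gp 𝔖) (bondsOverY i S) U = padDeltaLocCY i q 𝔮c 𝔮cs (DPDsCubeDY i q parS Gp 𝔖) (bondsOverY i S) U' :=
  padDeltaLocCY_congr_of_apply i q 𝔮c 𝔮cs _ _ (deltaLocC_sub_DPDsCubeDY_apply_congr 𝔖 hP hPr hB hp hq hqs)

end Generic

/-! ## §2 At the letters OF RECORD: `DP_□D* = DPDsDirCubeY i □ S`, `B = bondsOverY S`; the agreement predicate; the knit pair -/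

section OfRecord

variable (i : KIdx d ℓ hd hL b₀ b₁) (q : ↥(cubes (toKT i).D.toDomains)) {U U' : CfgY 𝔸 i}

/-- ★★ **THE AGREEMENT PREDICATE OF THE (C) BOND LETTER OF RECORD** `AgreeDirCY i □ D S U U′` — `U = U′` on exactly what `G_□(U) = GDirCY 𝔮_□ 𝔮⋆_□ (DPDsDirCubeY i □ S) (bondsOverY S) U`
reads: (i) the bonds at the sites of `S` (both directions), (ii) the bonds at the sites of the `𝔅_□`-block hull of `S`, (iii) the edges of the plaquettes of the Hessian's rows through
the bonds over `S` (clauses (i)–(iii) of ✓`AgreeDirBY`), (iv) the dependency sets `D ι` of the cube sequence's averaging letter meeting the bonds over `S`.  Print: all of it lies in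
`□̃⁵`. [cite: Balaban1985BackgroundPropagators, p.410 L14–15, p.413, p.409 l.1–5, dictionary] -/
def AgreeDirCY (D : IBondCubeY i q → Set (FBondY i)) (S : Finset (SiteY i)) (U U' : CfgY 𝔸 i) : Prop :=
  (∀ z ∈ S, ∀ μ, UboxY i U μ z = UboxY i U' μ z ∧ UboxY i U μ ((shiftY i μ).symm z) = UboxY i U' μ ((shiftY i μ).symm z)) ∧
  (∀ v ∈ blkHullCubeY i q S, ∀ μ, UboxY i U μ v = UboxY i U' μ v) ∧
  (∀ b : FBondY i, chartY i b.src ∈ S → ∀ p, (cocurlK i b p ≠ 0 ∨ ∃ m, edgeY i p m = b) → PlaqAgreeY i U U' p) ∧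
  (∀ ι, (∃ b ∈ D ι, chartY i b.src ∈ S) → ∀ b ∈ D ι, U b.dir b.src = U' b.dir b.src)

variable {i q}

/-- clause (i) gives the bond agreement over `S` in torus coordinates. [cite: Balaban1985BackgroundPropagators, (3.3) p.390, dictionary] -/
theorem AgreeDirCY.bond {D : IBondCubeY i q → Set (FBondY i)} {S : Finset (SiteY i)} (h : AgreeDirCY i q D S U U') (b : FBondY i) (hb : chartY i b.src ∈ S) :
    U b.dir b.src = U' b.dir b.src := by
  rw [← UboxY_chartY i U, ← UboxY_chartY i U']
  exact (h.1 _ hb b.dir).1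

/-- clause (iv) gives the row-locality premise of `𝔮⋆_□` at every bond over `S`. [cite: Balaban1985BackgroundPropagators, (3.13) p.393, p.413, bookkeeping] -/
theorem AgreeDirCY.dep {D : IBondCubeY i q → Set (FBondY i)} {S : Finset (SiteY i)} (h : AgreeDirCY i q D S U U') {b : FBondY i} (hb : chartY i b.src ∈ S) :
    ∀ ι, b ∈ D ι → ∀ b' ∈ D ι, U b'.dir b'.src = U' b'.dir b'.src := fun ι hι =>
  h.2.2.2 ι ⟨b, hι, hb⟩

variable (i q)

/-- ★★★ **`G_□(U) = G_□(U′)` AT THE (C) LETTERS OF RECORD** — print's «`G_□(U)` depends on `U` restricted to `Ω₀(□)`» for the Dirichlet bond inverse of the cube sequence keyed on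
a cube pair: from `AgreeDirCY i □ D S U U′`, (L2) `IsLocalQC D 𝔮_□` and the row locality `IsLocalQCs D 𝔮⋆_□`.
[cite: Balaban1985BackgroundPropagators, p.409 l.3–5 («G_□(U)»), p.410 L14–15, p.413, (3.105) p.414] -/
theorem GDirCY_DPDsDirCubeY_congr {D : IBondCubeY i q → Set (FBondY i)} {𝔮c : QCLetterY 𝔸 i q} {𝔮cs : QCsLetterY 𝔸 i q} (hloc : IsLocalQC i q D 𝔮c)
    (hlocs : IsLocalQCs i q D 𝔮cs) (S : Finset (SiteY i)) (h : AgreeDirCY i q D S U U') :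
    GDirCY i q 𝔮c 𝔮cs (DPDsDirCubeY i q S) (bondsOverY i S) U = GDirCY i q 𝔮c 𝔮cs (DPDsDirCubeY i q S) (bondsOverY i S) U' :=
  GDirCY_DPDsCubeDY_congr (insideBlkY i q S) (PDirCubeY_congr_of_agree i q S h.1 h.2.1) (GpDirY_mul_cubeProjY i q _ S U') h.bond h.2.2.1
    (fun _ hA => qc_congr_of_isLocalQC hloc (fun ι ⟨b, hb, hbB⟩ => h.2.2.2 ι ⟨b, hb, (mem_bondsOverY i).1 hbB⟩) hA)
    (fun _ hb => hlocs U U' _ (h.dep hb))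

/-- ★★ and the regime object of record agrees. [cite: Balaban1985BackgroundPropagators, p.409 l.3–5, p.410 L14–15, bookkeeping] -/
theorem padDeltaLocCY_DPDsDirCubeY_congr {D : IBondCubeY i q → Set (FBondY i)} {𝔮c : QCLetterY 𝔸 i q} {𝔮cs : QCsLetterY 𝔸 i q} (hloc : IsLocalQC i q D 𝔮c)
    (hlocs : IsLocalQCs i q D 𝔮cs) (S : Finset (SiteY i)) (h : AgreeDirCY i q D S U U') :
    padDeltaLocCY i q 𝔮c 𝔮cs (DPDsDirCubeY i q S) (bondsOverY i S) U = padDeltaLocCY i q 𝔮c 𝔮cs (DPDsDirCubeY i q S) (bondsOverY i S) U' :=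
  padDeltaLocCY_DPDsCubeDY_congr (insideBlkY i q S) (PDirCubeY_congr_of_agree i q S h.1 h.2.1) (GpDirY_mul_cubeProjY i q _ S U') h.bond h.2.2.1
    (fun _ hA => qc_congr_of_isLocalQC hloc (fun ι ⟨b, hb, hbB⟩ => h.2.2.2 ι ⟨b, hb, (mem_bondsOverY i).1 hbB⟩) hA)
    (fun _ hb => hlocs U U' _ (h.dep hb))

/-- ★ hence the regime hypotheses of record agree: `IsUnit (padDeltaLocCY … U) ↔ IsUnit (padDeltaLocCY … U′)`. [cite: Balaban1985BackgroundPropagators, p.409 l.3–5, Cor. 3.6 p.408, bookkeeping] -/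
theorem isUnit_padDeltaLocCY_DPDsDirCubeY_iff {D : IBondCubeY i q → Set (FBondY i)} {𝔮c : QCLetterY 𝔸 i q} {𝔮cs : QCsLetterY 𝔸 i q} (hloc : IsLocalQC i q D 𝔮c)
    (hlocs : IsLocalQCs i q D 𝔮cs) (S : Finset (SiteY i)) (h : AgreeDirCY i q D S U U') :
    IsUnit (padDeltaLocCY i q 𝔮c 𝔮cs (DPDsDirCubeY i q S) (bondsOverY i S) U) ↔ IsUnit (padDeltaLocCY i q 𝔮c 𝔮cs (DPDsDirCubeY i q S) (bondsOverY i S) U') := by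
  rw [padDeltaLocCY_DPDsDirCubeY_congr i q hloc hlocs S h]

end OfRecord

section KnitPair

variable {N : ℕ} [Nonempty (Fin N)] (i : KIdx d ℓ hd hL b₀ b₁) (q : ↥(cubes (toKT i).D.toDomains)) {U U' : CfgY (Matrix (Fin N) (Fin N) ℂ) i}

/-- ★★★ **`G_□(U) = G_□(U′)` FOR THE (C) LETTER OF RECORD `GDirCKY`** (the cube sequence's knit pair): from `AgreeDirCY` with the knit dependency sets `knitDepP i ι.1`.
[cite: Balaban1985BackgroundPropagators, p.409 l.3–5 («G_□(U)»), p.410 L14–15, p.413; Balaban1985Averaging, p.24] -/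
theorem GDirCKY_congr_of_agreeDirCY (S : Finset (SiteY i)) (h : AgreeDirCY i q (fun ι => knitDepP i ι.1) S U U') :
    GDirCKY i q (DPDsDirCubeY i q S) (bondsOverY i S) U = GDirCKY i q (DPDsDirCubeY i q S) (bondsOverY i S) U' :=
  GDirCY_DPDsDirCubeY_congr i q (isLocalQC_QknitCubeY i q) (isLocalQCs_QsknitCubeY i q) S h

/-- ★★ and the regime hypotheses of record at the knit pair agree. [cite: Balaban1985BackgroundPropagators, p.409 l.3–5, Cor. 3.6 p.408, bookkeeping] -/
theorem isUnit_padDeltaLocCY_knit_iff_of_agreeDirCY (S : Finset (SiteY i)) (h : AgreeDirCY i q (fun ι => knitDepP i ι.1) S U U') :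
    IsUnit (padDeltaLocCY i q (QknitCubeY i q) (QsknitCubeY i q) (DPDsDirCubeY i q S) (bondsOverY i S) U) ↔
      IsUnit (padDeltaLocCY i q (QknitCubeY i q) (QsknitCubeY i q) (DPDsDirCubeY i q S) (bondsOverY i S) U') :=
  isUnit_padDeltaLocCY_DPDsDirCubeY_iff i q (isLocalQC_QknitCubeY i q) (isLocalQCs_QsknitCubeY i q) S h

end KnitPair

/-! ## §3 At a member: the `hOagrA` row of the (C) heads from `agree310WalkYO` -/

section Member

variable {Mstar : ℕ} (x : MemberY d ℓ hd hL b₀ b₁ Mstar) (B : B9.Backgrounds) (cfg : B.Cfg → CfgY 𝔸 x.toKIdx) (c : ↥(cubes x.toKIdx.D.toDomains))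

/-- ★ **`agree310WalkYO near □ U U′` WITH `bondReadSetY S ⊆ near □` AND THE DEPENDENCY-SET INCLUSION GIVES `AgreeDirCY`** (clauses (i)–(iii) through ✓`agreeDirBY_of_agree310WalkYO`).
[cite: Balaban1985BackgroundPropagators, p.410 L14–15, (3.100) p.413, dictionary] -/
theorem agreeDirCY_of_agree310WalkYO (near : ↥(cubes x.toKIdx.D.toDomains) → Finset (SiteY x.toKIdx)) (S : Finset (SiteY x.toKIdx))
    (D : IBondCubeY x.toKIdx c → Set (FBondY x.toKIdx)) (hS : bondReadSetY x.toKIdx c S ⊆ near c)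
    (hD : ∀ ι, (∃ b ∈ D ι, chartY x.toKIdx b.src ∈ S) → ∀ b' ∈ D ι, chartY x.toKIdx b'.src ∈ near c) {U U' : B.Cfg}
    (h : agree310WalkYO x B cfg near c U U') : AgreeDirCY x.toKIdx c D S (cfg U) (cfg U') := by
  have hfwd : ∀ w : Site (PV d ℓ x.toKIdx.m x.toKIdx.K hd hL) 0, chartY x.toKIdx w ∈ near c → ∀ μ, cfg U μ w = cfg U' μ w := fun w hw μ => by
    rw [← UboxY_chartY x.toKIdx (cfg U), ← UboxY_chartY x.toKIdx (cfg U')]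
    exact (h _ hw μ).1
  have h3 : AgreeDirBY x.toKIdx c (fun _ : IBondY x.toKIdx => (∅ : Set (FBondY x.toKIdx))) S (cfg U) (cfg U') :=
    agreeDirBY_of_agree310WalkYO x B cfg c near S (fun _ => ∅) hS (fun ι ⟨b, hb, _⟩ => absurd hb (Set.notMem_empty b)) h
  exact ⟨h3.1, h3.2.1, h3.2.2.1, fun ι hι b' hb' => hfwd _ (hD ι hι b' hb') _⟩

end Member

section MemberKnit

variable {N : ℕ} [Nonempty (Fin N)] {Mstar : ℕ} (x : MemberY d ℓ hd hL b₀ b₁ Mstar) (B : B9.Backgrounds)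
  (cfg : B.Cfg → CfgY (Matrix (Fin N) (Fin N) ℂ) x.toKIdx) (c : ↥(cubes x.toKIdx.D.toDomains))

/-- ★★★ **THE `hOagrA` ROW OF THE (C) HEADS**: the bond-sector walk reading's agreement predicate `agree310WalkYO near □ U U′` gives `G_□(U) = G_□(U′)` at the (C) bond letter of record
`GDirCKY x.toKIdx □ (DPDsDirCubeY x.toKIdx □ S) (bondsOverY S)` whenever the reading domain `near □` contains the reading set `bondReadSetY x.toKIdx □ S` and the source sites of every knit
dependency set of the cube sequence's index bonds meeting the bonds over `S`. [cite: Balaban1985BackgroundPropagators, p.410 L14–15 («depend on U restricted to Ω₀(□) ⊂ □̃⁵»), p.413, p.409 l.3–5; Balaban1985Averaging, p.24] -/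
theorem GDirCKY_congr_of_agree310WalkYO (near : ↥(cubes x.toKIdx.D.toDomains) → Finset (SiteY x.toKIdx)) (S : Finset (SiteY x.toKIdx))
    (hS : bondReadSetY x.toKIdx c S ⊆ near c)
    (hD : ∀ ι : IBondCubeY x.toKIdx c, (∃ b ∈ knitDepP x.toKIdx ι.1, chartY x.toKIdx b.src ∈ S) → ∀ b' ∈ knitDepP x.toKIdx ι.1, chartY x.toKIdx b'.src ∈ near c)
    {U U' : B.Cfg} (h : agree310WalkYO x B cfg near c U U') :
    GDirCKY x.toKIdx c (DPDsDirCubeY x.toKIdx c S) (bondsOverY x.toKIdx S) (cfg U) = GDirCKY x.toKIdx c (DPDsDirCubeY x.toKIdx c S) (bondsOverY x.toKIdx S) (cfg U') :=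
  GDirCKY_congr_of_agreeDirCY x.toKIdx c S (agreeDirCY_of_agree310WalkYO x B cfg c near S (fun ι => knitDepP x.toKIdx ι.1) hS hD h)

/-- ★★ and the regime hypotheses `hUnitA` of the (C) heads agree under the same reading. [cite: Balaban1985BackgroundPropagators, p.409 l.3–5, Cor. 3.6 p.408, p.410 L14–15] -/
theorem isUnit_padDeltaLocCY_knit_iff_of_agree310WalkYO (near : ↥(cubes x.toKIdx.D.toDomains) → Finset (SiteY x.toKIdx)) (S : Finset (SiteY x.toKIdx))
    (hS : bondReadSetY x.toKIdx c S ⊆ near c)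
    (hD : ∀ ι : IBondCubeY x.toKIdx c, (∃ b ∈ knitDepP x.toKIdx ι.1, chartY x.toKIdx b.src ∈ S) → ∀ b' ∈ knitDepP x.toKIdx ι.1, chartY x.toKIdx b'.src ∈ near c)
    {U U' : B.Cfg} (h : agree310WalkYO x B cfg near c U U') :
    IsUnit (padDeltaLocCY x.toKIdx c (QknitCubeY x.toKIdx c) (QsknitCubeY x.toKIdx c) (DPDsDirCubeY x.toKIdx c S) (bondsOverY x.toKIdx S) (cfg U)) ↔
      IsUnit (padDeltaLocCY x.toKIdx c (QknitCubeY x.toKIdx c) (QsknitCubeY x.toKIdx c) (DPDsDirCubeY x.toKIdx c S) (bondsOverY x.toKIdx S) (cfg U')) :=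
  isUnit_padDeltaLocCY_knit_iff_of_agreeDirCY x.toKIdx c S (agreeDirCY_of_agree310WalkYO x B cfg c near S (fun ι => knitDepP x.toKIdx ι.1) hS hD h)

end MemberKnit

end Literature.MathematicalPhysics.QuantumFieldTheory.Balaban1983to89.B9CubeDirInverseBondCLocalityAtRecordY

end
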